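import Summits.QuantumFields.YangMills.Theorems.BalabanUVNodesN22ReadingOfRecord13CoPHComponentCensus

/-!
# BalabanUVNodes ∕ node N22 — THE COMPONENT CENSUS OF THE STAGE-13 `CoPH` READING OF RECORD, PART 2: INSIDE `w1` AT node00-def-W1's GENERATED TABLES
# `ReadingData.ofRecordGen F M N Pplus T₀ S gauge hg li` (`sp := spGen F M N Pplus T₀`, `hT₀ := hT₀_spGen`) — WHERE THE TRANSPORT `T₀` IS READ BY N22 (through the tables only)

Cell `pub-ymgap` (HUMAN RULING D-0062 Track A; D-0149 width seats, director-ym №197), seat `pub-ymgap-dag-n22-w3` (WIDTH SEAT 3 of 3 on node n22 = NE9), gen 0, module 2 (twin of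
module 1 `…N22ReadingOfRecord13CoPHComponentCensus` p583778, §3∕§4, in the `spGen` currency).  `--kind proof --supports stmt-QuantumFields-20544 --as helper` (K3⁷
`SpineGivenEndpointR13SepCoPH`).  COUNT-NEUTRAL.  THEOREMS ONLY, 0 `def`, 0 `sorry`; restates nothing (module 1 and node00-def-W1's `Node00/RateRecordW1MapsAdm` §4 APPLIED by name);
no Theses import.

WHY (sharpening module 1's census for plan g77's K3⁷ skeleton v2 «`∃ over the rest`»).  Module 1 §3 certifies that at def-W1's ADMISSIBLE reading `ReadingData.ofRecordAdm F M N S sp gauge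
hg T₀ hT₀ li` — tables `sp` a FREE parameter — N22's slot reads the towers `S`, the tables `sp` and seven letters, and NOT the transport `T₀`.  At def-W1's v1.1 GENERATED reading
`ReadingData.ofRecordGen F M N Pplus T₀ S gauge hg li` the tables are NOT free: `sp := W1.spGen F M N Pplus T₀` is the averaging-closure of the strictly small fields `Pplus` under the
one-step transports `T₀` ([Balaban1987RG1] p.262 (iv) read as a closure), and `hT₀ := W1.hT₀_spGen` is a theorem.  So THERE N22's slot DOES read `T₀` (and `Pplus`) — but ONLY through
the admissible class `W1.AdmBg F M N (spGen F M N Pplus T₀) k` over which the history-Lipschitz inequality is quantified, NEVER through the pairing's transport slot: replacing the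
transport by ANY `T₀'` that preserves the `T₀`-generated tables leaves the slot unchanged (§2).  Consequence for v2: an «∃ over `T₀`» is free for N22 exactly when the TABLES are
pinned independently of it; at the generated tables `T₀` is load-bearing for N22 together with `Pplus`, `S` and the letters `κ θ₅ C₀ A μ r s`.

WHAT IS KERNEL-CHECKED ([bookkeeping]):
* §1 `n22At_u3OfRecord₁₃_ofRecordGen_iff_explicit` (`Iff.rfl`): N22's slot at run length `k` inside the generated reading IS «∀ g g′ ∈ ]0, θ.γ], ∀ `U : AdmBg F θ.τ9.M N (spGen F θ.τ9.M N
  (Pplus F θ) (T₀ F θ)) k`, ∀ (j, X): |Re E(S F θ k)(X; g; (ιU,0)) − Re E(S F θ k)(X; g′; (ιU,0))| ≤ e^{−κ d_j(X)} Σ_{i<j} C₉ ω^{j−i}|g_i − g′_i|» ∧ fading memory (letters as in module 1).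
* §2 `s_N22_readingGen₁₃CoPH_iff_transportSlot` ∕ `s_N22_readingGen₁₃CoPHOn_iff_transportSlot`: the generated reading's N22 slot = the admissible reading's at the `T₀`-GENERATED tables
  with ANY transport `T₀'` preserving them, any gauge, any `C₅ cr ρ`, any `ℓ₃' ne2' ne1'` (module 1's `s_N22_readingAdm₁₃CoPH(On)_indep` at `sp := spGen …`, `ofRecordGen_eq` by `rfl`);
  `s_N22_readingGen₁₃CoPH_indep` ∕ `…CoPHOn_indep`: inside the generated reading the gauge, `C₅ cr ρ` and `ℓ₃ ne2 ne1` are idle for N22.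
* §3 the other node-U3 slots at the generated reading: `s_N18_readingGen₁₃CoPH_indep` (gauge and `C₀ A μ r s` idle; `Pplus T₀ S κ θ₅ C₅` read — `T₀` twice: tables AND transport),
  `s_D4_readingGen₁₃CoPH_indep` (gauge idle), `s_N17_readingGen₁₃CoPH_indep` (EVERY W1 object idle, `Pplus T₀ S` included: letters `cr C₅ θ₅ ρ` only).

HONEST FRAMING.  Kernel bookkeeping of a reading's DATA DEPENDENCE; no estimate; nothing of Bałaban's asserted or instantiated (`Pplus`, `T₀`, `S`, `li`, the gauge are PARAMETERS; the
closure reading of [I] (iv) is def-W1's located convention, its inclusion in print's tables `spGen_subset_of_origin` a displayed clause there); NE9 ∕ fading memory NOT PRINTED for d = 4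
and NOT PROVED; no inhabitant of `IsDatumOfRecord₁₃CCoPH` ∕ `Provisos₁₃CoPH` claimed (K0⁷ stmt-QuantumFields-20541 OPEN); N22 NOT discharged; K3⁷ NOT claimed; no count claim (the chair's
count line is the only count; typed 28∕28 · discharged 5∕27, A 5∕28 UNMOVED); one finite four-torus programme at fixed `ε` — R4 closes the CONDITIONAL rung `BalabanLadder.UV` only; the
Yang–Mills mass gap (Clay) is NOT proved by any of this; NOT ℝ⁴, NOT infinite volume, NOT OS, NOT a mass gap.  No decl below carries a cite tag.
-/

noncomputable section

namespace YMDAG.N22.ComponentCensus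

open scoped BigOperators
open Literature.MathematicalPhysics.QuantumFieldTheory.Balaban1983to89
open Literature.MathematicalPhysics.QuantumFieldTheory.Balaban1983to89.T4Continuum
open Literature.MathematicalPhysics.QuantumFieldTheory.Balaban1983to89.T4OutputRate (Window NE9 FadingMemory)
open Literature.MathematicalPhysics.QuantumFieldTheory.Balaban1983to89.Node00
  (Stage13HParams datumOfRecord₁₃CoPH IsDatumOfRecord₁₃CCoPH NE3Letters₁₁ NE2Objects₁₁ MatA ιSU)
open Literature.MathematicalPhysics.QuantumFieldTheory.Balaban1983to89.Node00.Sect2 (domSys CPair ofBackgroundC)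
open Literature.MathematicalPhysics.QuantumFieldTheory.Balaban1983to89.Node00.W1 (ReadingData LetterInputs ClusterTower functionalC AdmBg spGen hT₀_spGen)
open YMDAG.UVSplit

variable {N : ℕ} [NeZero N]

variable
  (S S' : (F : T4Family) → (θ : Stage13HParams F N) → (k : ℕ) → ClusterTower (F.P k) (MatA N) θ.τ9.M)
  (Pplus Pplus' : (F : T4Family) → (θ : Stage13HParams F N) → (k : ℕ) → GaugeField (F.P k) 0 (Node00.SU N) → Prop)
  (T₀ T₀'' : (F : T4Family) → (θ : Stage13HParams F N) → (k : ℕ) → GaugeField (F.P (k + 1)) 0 (Node00.SU N) → GaugeField (F.P k) 0 (Node00.SU N))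
  (gauge gauge' : (F : T4Family) → (θ : Stage13HParams F N) → (k : ℕ) → GaugeField (F.P k) 0 (Node00.SU N) → GaugeField (F.P k) 0 (Node00.SU N) → ℝ)
  (hg : ∀ (F : T4Family) (θ : Stage13HParams F N) (k : ℕ) (U U' : GaugeField (F.P k) 0 (Node00.SU N)), 0 ≤ gauge F θ k U U')
  (hg' : ∀ (F : T4Family) (θ : Stage13HParams F N) (k : ℕ) (U U' : GaugeField (F.P k) 0 (Node00.SU N)), 0 ≤ gauge' F θ k U U')
  (li : (F : T4Family) → Stage13HParams F N → LetterInputs) (κ' C₅' cr' ρ' C₀' A' μ' r' s' : (F : T4Family) → Stage13HParams F N → ℝ)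
  (ℓ₃ ℓ₃' : T4Family → NE3Letters₁₁)
  (ne2 ne2' : (F : T4Family) → Stage13HParams F N → (ℕ → ℝ) → List (ULoop F) → ℕ → NE2Objects₁₁)
  (ne1 ne1' : (F : T4Family) → Stage13HParams F N → (ℕ → ℝ) → List (ULoop F) → NE1pCarriers)
  -- a SECOND transport, asked only to preserve the `T₀`-GENERATED tables (the transport slot of the pairing; §2)
  (T₀' : (F : T4Family) → (θ : Stage13HParams F N) → (k : ℕ) → GaugeField (F.P (k + 1)) 0 (Node00.SU N) → GaugeField (F.P k) 0 (Node00.SU N))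
  (hT₀' : ∀ (F : T4Family) (θ : Stage13HParams F N) (k : ℕ) (U : GaugeField (F.P (k + 1)) 0 (Node00.SU N)),
    (∀ (j : ℕ) (Y : (domSys (F.P (k + 1)) θ.τ9.M j).Dom), ofBackgroundC (ιSU N) U ∈ spGen F θ.τ9.M N (Pplus F θ) (T₀ F θ) (k + 1) j Y) →
    ∀ (j : ℕ) (Y : (domSys (F.P k) θ.τ9.M j).Dom), ofBackgroundC (ιSU N) (T₀' F θ k U) ∈ spGen F θ.τ9.M N (Pplus F θ) (T₀ F θ) k j Y)

/-! ## §1 What N22's slot is inside the GENERATED reading -/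

/-- **WHAT N22's SLOT IS, AT RUN LENGTH `k`, INSIDE THE GENERATED W1 READING** (`Iff.rfl`): the joint history-Lipschitz inequality for `Re E(S F θ k)(X; ·; (ιU, 0))` over the
`T₀`-GENERATED admissible class `U : AdmBg F θ.τ9.M N (spGen F θ.τ9.M N (Pplus F θ) (T₀ F θ)) k` (averaging-closure of the strictly small fields) on `]0, θ.γ]`, AND fading memory —
letters as in module 1 §3.  `Pplus` and `T₀` occur (in the class), the gauge and `C₅ cr ρ` do not. -/
theorem n22At_u3OfRecord₁₃_ofRecordGen_iff_explicit {F : T4Family} (θ : Stage13HParams F N) (k : ℕ) :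
    N22At (u3OfRecord₁₃ θ.toStage13Params
        ((ReadingData.ofRecordGen F θ.τ9.M N (Pplus F θ) (T₀ F θ) (S F θ) (gauge F θ) (hg F θ) (li F θ)).u3Objects θ.γ) k) ↔
      (∀ g ∈ Window θ.γ, ∀ g' ∈ Window θ.γ, ∀ (U : AdmBg F θ.τ9.M N (spGen F θ.τ9.M N (Pplus F θ) (T₀ F θ)) k) (X : Node00.W1.Dom (F.P k) θ.τ9.M),
          |(functionalC (S F θ k) g (ofBackgroundC (ιSU N) U.1) X).re - (functionalC (S F θ k) g' (ofBackgroundC (ιSU N) U.1) X).re| ≤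
            Real.exp (-((li F θ).κ * (domSys (F.P k) θ.τ9.M X.1).dj X.2)) *
              ∑ i ∈ Finset.range X.1,
                32 / ((li F θ).s ^ 2 * min ((li F θ).r / 2) (θ.γ / 2)) * ((li F θ).C₀ ^ (1 - (li F θ).s) * (2 * (li F θ).A) ^ (li F θ).s) /
                    ((li F θ).θ₅ ^ (1 - (li F θ).s) * (li F θ).μ ^ (li F θ).s) *
                  ((li F θ).θ₅ ^ (1 - (li F θ).s) * (li F θ).μ ^ (li F θ).s) ^ (X.1 - i) * |g i - g' i|) ∧
        FadingMemory
          (32 / ((li F θ).s ^ 2 * min ((li F θ).r / 2) (θ.γ / 2)) * ((li F θ).C₀ ^ (1 - (li F θ).s) * (2 * (li F θ).A) ^ (li F θ).s) /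
            ((li F θ).θ₅ ^ (1 - (li F θ).s) * (li F θ).μ ^ (li F θ).s))
          ((li F θ).θ₅ ^ (1 - (li F θ).s) * (li F θ).μ ^ (li F θ).s)
          (fun a i => 32 / ((li F θ).s ^ 2 * min ((li F θ).r / 2) (θ.γ / 2)) * ((li F θ).C₀ ^ (1 - (li F θ).s) * (2 * (li F θ).A) ^ (li F θ).s) /
              ((li F θ).θ₅ ^ (1 - (li F θ).s) * (li F θ).μ ^ (li F θ).s) *
            ((li F θ).θ₅ ^ (1 - (li F θ).s) * (li F θ).μ ^ (li F θ).s) ^ (a - i)) :=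
  Iff.rfl

/-! ## §2 The transport is read THROUGH THE TABLES ONLY: the generated reading's N22 slot vs the admissible reading at the `T₀`-generated tables with another transport -/

/-- **THE GENERATED READING's N22 SLOT = THE ADMISSIBLE READING's AT THE `T₀`-GENERATED TABLES WITH ANY TABLE-PRESERVING TRANSPORT `T₀'`** (datum-keyed home), any gauge, any
`C₅ cr ρ`, any `ℓ₃' ne2' ne1'` on the right: `T₀` enters N22's slot through `spGen … Pplus T₀` alone (module 1's `s_N22_readingAdm₁₃CoPH_indep` at `sp := spGen`, def-W1's
`ofRecordGen_eq` by `rfl`). -/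
theorem s_N22_readingGen₁₃CoPH_iff_transportSlot :
    S_N22 (RRec₁₃CoPH (readingOfRecord₁₃CoPH
        (fun F θ => ReadingData.ofRecordGen F θ.τ9.M N (Pplus F θ) (T₀ F θ) (S F θ) (gauge F θ) (hg F θ) (li F θ)) ℓ₃ ne2 ne1)) ↔
    S_N22 (RRec₁₃CoPH (readingOfRecord₁₃CoPH
        (fun F θ => ReadingData.ofRecordAdm F θ.τ9.M N (S F θ) (spGen F θ.τ9.M N (Pplus F θ) (T₀ F θ)) (gauge' F θ) (hg' F θ) (T₀' F θ) (hT₀' F θ)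
          { li F θ with C₅ := C₅' F θ, cr := cr' F θ, ρ := ρ' F θ }) ℓ₃' ne2' ne1')) :=
  s_N22_readingAdm₁₃CoPH_indep S (fun F θ => spGen F θ.τ9.M N (Pplus F θ) (T₀ F θ)) gauge gauge' hg hg' T₀ T₀'
    (fun F θ => hT₀_spGen F θ.τ9.M N (Pplus F θ) (T₀ F θ)) hT₀' li C₅' cr' ρ' ℓ₃ ℓ₃' ne2 ne2' ne1 ne1'

/-- **The same at the regime home** (any `Rg`; guarded θ-form). -/
theorem s_N22_readingGen₁₃CoPHOn_iff_transportSlot (Rg : (F : T4Family) → Stage13HParams F N → Prop) :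
    S_N22 (RRec₁₃CoPHOn (readingOfRecord₁₃CoPH
        (fun F θ => ReadingData.ofRecordGen F θ.τ9.M N (Pplus F θ) (T₀ F θ) (S F θ) (gauge F θ) (hg F θ) (li F θ)) ℓ₃ ne2 ne1) Rg) ↔
    S_N22 (RRec₁₃CoPHOn (readingOfRecord₁₃CoPH
        (fun F θ => ReadingData.ofRecordAdm F θ.τ9.M N (S F θ) (spGen F θ.τ9.M N (Pplus F θ) (T₀ F θ)) (gauge' F θ) (hg' F θ) (T₀' F θ) (hT₀' F θ)
          { li F θ with C₅ := C₅' F θ, cr := cr' F θ, ρ := ρ' F θ }) ℓ₃' ne2' ne1') Rg) :=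
  s_N22_readingAdm₁₃CoPHOn_indep S (fun F θ => spGen F θ.τ9.M N (Pplus F θ) (T₀ F θ)) gauge gauge' hg hg' T₀ T₀'
    (fun F θ => hT₀_spGen F θ.τ9.M N (Pplus F θ) (T₀ F θ)) hT₀' li C₅' cr' ρ' ℓ₃ ℓ₃' ne2 ne2' ne1 ne1' Rg

/-- **INSIDE THE GENERATED READING THE GAUGE, `C₅ cr ρ` AND `ℓ₃ ne2 ne1` ARE IDLE FOR N22** (datum-keyed home); `Pplus`, `T₀`, `S`, `κ θ₅ C₀ A μ r s` are what it reads. -/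
theorem s_N22_readingGen₁₃CoPH_indep :
    S_N22 (RRec₁₃CoPH (readingOfRecord₁₃CoPH
        (fun F θ => ReadingData.ofRecordGen F θ.τ9.M N (Pplus F θ) (T₀ F θ) (S F θ) (gauge F θ) (hg F θ) (li F θ)) ℓ₃ ne2 ne1)) ↔
    S_N22 (RRec₁₃CoPH (readingOfRecord₁₃CoPH
        (fun F θ => ReadingData.ofRecordGen F θ.τ9.M N (Pplus F θ) (T₀ F θ) (S F θ) (gauge' F θ) (hg' F θ)
          { li F θ with C₅ := C₅' F θ, cr := cr' F θ, ρ := ρ' F θ }) ℓ₃' ne2' ne1')) :=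
  s_N22_readingAdm₁₃CoPH_indep S (fun F θ => spGen F θ.τ9.M N (Pplus F θ) (T₀ F θ)) gauge gauge' hg hg' T₀ T₀
    (fun F θ => hT₀_spGen F θ.τ9.M N (Pplus F θ) (T₀ F θ)) (fun F θ => hT₀_spGen F θ.τ9.M N (Pplus F θ) (T₀ F θ)) li C₅' cr' ρ' ℓ₃ ℓ₃' ne2 ne2' ne1 ne1'

/-- **The same at the regime home** (any `Rg`). -/
theorem s_N22_readingGen₁₃CoPHOn_indep (Rg : (F : T4Family) → Stage13HParams F N → Prop) :
    S_N22 (RRec₁₃CoPHOn (readingOfRecord₁₃CoPH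
        (fun F θ => ReadingData.ofRecordGen F θ.τ9.M N (Pplus F θ) (T₀ F θ) (S F θ) (gauge F θ) (hg F θ) (li F θ)) ℓ₃ ne2 ne1) Rg) ↔
    S_N22 (RRec₁₃CoPHOn (readingOfRecord₁₃CoPH
        (fun F θ => ReadingData.ofRecordGen F θ.τ9.M N (Pplus F θ) (T₀ F θ) (S F θ) (gauge' F θ) (hg' F θ)
          { li F θ with C₅ := C₅' F θ, cr := cr' F θ, ρ := ρ' F θ }) ℓ₃' ne2' ne1') Rg) :=
  s_N22_readingAdm₁₃CoPHOn_indep S (fun F θ => spGen F θ.τ9.M N (Pplus F θ) (T₀ F θ)) gauge gauge' hg hg' T₀ T₀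
    (fun F θ => hT₀_spGen F θ.τ9.M N (Pplus F θ) (T₀ F θ)) (fun F θ => hT₀_spGen F θ.τ9.M N (Pplus F θ) (T₀ F θ)) li C₅' cr' ρ' ℓ₃ ℓ₃' ne2 ne2' ne1 ne1' Rg

/-! ## §3 The other node-U3 slots inside the generated reading -/

/-- **N18's SLOT INSIDE THE GENERATED READING: THE GAUGE AND `C₀ A μ r s` ARE IDLE** (it reads `Pplus`, `T₀` — in the tables AND as the transport —, `S F θ k`, `S F θ (k+1)`,
`κ θ₅ C₅`). -/
theorem s_N18_readingGen₁₃CoPH_indep :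
    S_N18 (RRec₁₃CoPH (readingOfRecord₁₃CoPH
        (fun F θ => ReadingData.ofRecordGen F θ.τ9.M N (Pplus F θ) (T₀ F θ) (S F θ) (gauge F θ) (hg F θ) (li F θ)) ℓ₃ ne2 ne1)) ↔
    S_N18 (RRec₁₃CoPH (readingOfRecord₁₃CoPH
        (fun F θ => ReadingData.ofRecordGen F θ.τ9.M N (Pplus F θ) (T₀ F θ) (S F θ) (gauge' F θ) (hg' F θ)
          { li F θ with C₀ := C₀' F θ, A := A' F θ, μ := μ' F θ, r := r' F θ, s := s' F θ }) ℓ₃' ne2' ne1')) :=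
  s_N18_readingAdm₁₃CoPH_indep S (fun F θ => spGen F θ.τ9.M N (Pplus F θ) (T₀ F θ)) gauge gauge' hg hg' T₀
    (fun F θ => hT₀_spGen F θ.τ9.M N (Pplus F θ) (T₀ F θ)) li ℓ₃ ℓ₃' ne2 ne2' ne1 ne1' C₀' A' μ' r' s'

/-- **THE (D4) READ-OUT SLOT INSIDE THE GENERATED READING: THE GAUGE IS IDLE.** -/
theorem s_D4_readingGen₁₃CoPH_indep :
    S_D4 (RRec₁₃CoPH (readingOfRecord₁₃CoPH
        (fun F θ => ReadingData.ofRecordGen F θ.τ9.M N (Pplus F θ) (T₀ F θ) (S F θ) (gauge F θ) (hg F θ) (li F θ)) ℓ₃ ne2 ne1)) ↔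
    S_D4 (RRec₁₃CoPH (readingOfRecord₁₃CoPH
        (fun F θ => ReadingData.ofRecordGen F θ.τ9.M N (Pplus F θ) (T₀ F θ) (S F θ) (gauge' F θ) (hg' F θ) (li F θ)) ℓ₃' ne2' ne1')) :=
  s_D4_readingAdm₁₃CoPH_indep S (fun F θ => spGen F θ.τ9.M N (Pplus F θ) (T₀ F θ)) gauge gauge' hg hg' T₀
    (fun F θ => hT₀_spGen F θ.τ9.M N (Pplus F θ) (T₀ F θ)) li ℓ₃ ℓ₃' ne2 ne2' ne1 ne1'

/-- **N17's SLOT INSIDE THE GENERATED READING READS NO W1 OBJECT — `Pplus`, `T₀`, `S`, the gauge, the letters `κ C₀ A μ r s` are ALL idle** (letters `cr C₅ θ₅ ρ` + the datum only). -/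
theorem s_N17_readingGen₁₃CoPH_indep :
    S_N17 (RRec₁₃CoPH (readingOfRecord₁₃CoPH
        (fun F θ => ReadingData.ofRecordGen F θ.τ9.M N (Pplus F θ) (T₀ F θ) (S F θ) (gauge F θ) (hg F θ) (li F θ)) ℓ₃ ne2 ne1)) ↔
    S_N17 (RRec₁₃CoPH (readingOfRecord₁₃CoPH
        (fun F θ => ReadingData.ofRecordGen F θ.τ9.M N (Pplus' F θ) (T₀'' F θ) (S' F θ) (gauge' F θ) (hg' F θ)
          { li F θ with κ := κ' F θ, C₀ := C₀' F θ, A := A' F θ, μ := μ' F θ, r := r' F θ, s := s' F θ }) ℓ₃' ne2' ne1')) :=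
  s_N17_readingAdm₁₃CoPH_indep S (fun F θ => spGen F θ.τ9.M N (Pplus F θ) (T₀ F θ)) gauge gauge' hg hg' T₀
    (fun F θ => hT₀_spGen F θ.τ9.M N (Pplus F θ) (T₀ F θ)) li ℓ₃ ℓ₃' ne2 ne2' ne1 ne1'
    S' (fun F θ => spGen F θ.τ9.M N (Pplus' F θ) (T₀'' F θ)) T₀'' (fun F θ => hT₀_spGen F θ.τ9.M N (Pplus' F θ) (T₀'' F θ)) κ' C₀' A' μ' r' s'

end YMDAG.N22.ComponentCensus

end
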